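import Summits.BirchSwinnertonDyer.Rank1Residual.Additive.X3ThreeLineDatum
import Summits.BirchSwinnertonDyer.Rank1Residual.X2.CellAGVParCertificatesN9A
import Mathlib.Tactic.Simproc.Factors
import HarnessLib

/-!
# X3♯(G-ord, `e = 2`) at `p = 3`: kernel records of the per-pair LINE DATUM `X3LineDatumThree W` for the
# Case-1 members of the B-X3G booking list — part J of 16 (cell `bsd-addord`, seat
# `bsd-addord-twist`, strategy = twist transport)

HONEST FRAMING (cell `bsd-addord`, `run/shared/lean/pub/bsd-addord/README.md` §4): the programme's
target of record is the full Birch–Swinnerton-Dyer formula for every `E/ℚ` of analytic rank `≤ 1`.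
DATA-RECORDS module: theorems only (no definition, no named fact, no `sorry`); it BOOKS NOTHING and
moves no mark — booking is the planner's act (TARGET.md v5.5 §8 protocol B-X3G, (iv)).

## What is recorded

For each isogeny class `(N, class, 3)` of the booking list `HOME/bsd-addord-twist-booking-members.tsv`
(kit job j242057; the r_an = 0, non-CM, non-degenerate branch-parity classes of cell (G-ord, `e = 2`) at
`p = 3` in census v2, planner keys `HOME/planner/bx3g/`), the CASE-1 MEMBER `W = [a₁, a₂, a₃, a₄, a₆]`
(Cremona's globally minimal model; the first member in Cremona order carrying the EVEN rational `3`-line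
as a SUB-line) and the theorem `X3LineDatumThree W` — SOME rational `3`-line `Φ₀ ≤ W[3]` which is even,
has non-trivial `Γ_ℚ`-action and `χ_{−3}`-twist ramified at `3` — proved by
`x3LineDatumThree_of_cert_of_delta` from the certificate `(x₀, s, D, q)`: `Ψ₃(x₀) = 0`, `D` squarefree,
`s ≠ 0`, `D·s² = Ψ₂Sq(x₀)`, `0 < D`, `D ≠ 1`, `3 ∤ D` (`norm_num` identities, one prime-factor-list
computation with X2a's helper `squarefree_of_nodup_primeFactorsList_natAbs`, `decide`s). This is the per-pair line-datum input of
`ClassX3Gord.{{missingLowerBoundAt,bsdp}}_three_rankZero_of_facts_of_nonAnomalous`; the class binders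
(`ClassX3Gord W 3`, `¬ HasCM`, `analyticRank = 0`, `ReductionNonAnomalous W 3`) are data of record
(Cremona / the planner's two-engine census), NOT kernel statements here; the other members of each class
are reached by Cassels (`N10.bsdp_of_isIsogenous_of_bsdp`, binder `bsdRHS_eq_of_isIsogenous`). The
docstring of each record names the class, the anomalous bit of the twist `V = W ⊗ χ_{−3}` and `D`
(`φ = χ_D`). Records sorted by conductor.

References: [GreenbergVatsal2000] §2 p. 28 (the line `Φ`); lane file
`HOME/bsd-addord-twist-booking-members.tsv`; `Additive/X3ThreeLineDatum.lean`.
-/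

set_option autoImplicit false

open WeierstrassCurve Polynomial Literature.NumberTheory.EllipticCurves
  Literature.NumberTheory.EllipticCurves.Rank1Residual

namespace Summit.BirchSwinnertonDyer.Rank1Residual.Additive.X3ThreeLineDatumRecords

/-- `258570bx3` = `[1,-1,0,-12803049,1366961805]` (class `258570bx`, (G-ord, `e = 2`) at `3`; twist `28730u3`, `a₃(V) = -2` — ANOMALOUS (outside the end state as typed); even line
`φ = χ_{13}`): `x₀ = 5158`, `D = 13`, `s = 149396`, `Ψ₂Sq(x₀) = 290149142608` ⇒ `X3LineDatumThree W`. [folklore] -/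
theorem x3LineDatumThree_258570bx3 : X3LineDatumThree (⟨1, -1, 0, -12803049, 1366961805⟩ : WeierstrassCurve ℚ) :=
  x3LineDatumThree_of_cert_of_delta _ (by norm_num [Δ, b₂, b₄, b₆, b₈]) 5158 149396 13
    (by simp only [Ψ₃, eval_add, eval_mul, eval_pow, eval_C, eval_X, eval_ofNat]; norm_num [b₂, b₄, b₆, b₈])
    (X2.CellACertN9.squarefree_of_nodup_primeFactorsList_natAbs (by norm_num) (by simp [Nat.primeFactorsList_ofNat])) (by norm_num)
    (by rw [KernelDisc.eval_Ψ₂Sq]; norm_num [b₂, b₄, b₆]) (by decide) (by decide) (by decide)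

/-- `258570ci2` = `[1,-1,0,-6688629,6656391405]` (class `258570ci`, (G-ord, `e = 2`) at `3`; twist `28730t2`, `a₃(V) = -2` — ANOMALOUS (outside the end state as typed); even line
`φ = χ_{13}`): `x₀ = 1648`, `D = 13`, `s = 5746`, `Ψ₂Sq(x₀) = 429214708` ⇒ `X3LineDatumThree W`. [folklore] -/
theorem x3LineDatumThree_258570ci2 : X3LineDatumThree (⟨1, -1, 0, -6688629, 6656391405⟩ : WeierstrassCurve ℚ) :=
  x3LineDatumThree_of_cert_of_delta _ (by norm_num [Δ, b₂, b₄, b₆, b₈]) 1648 5746 13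
    (by simp only [Ψ₃, eval_add, eval_mul, eval_pow, eval_C, eval_X, eval_ofNat]; norm_num [b₂, b₄, b₆, b₈])
    (X2.CellACertN9.squarefree_of_nodup_primeFactorsList_natAbs (by norm_num) (by simp [Nat.primeFactorsList_ofNat])) (by norm_num)
    (by rw [KernelDisc.eval_Ψ₂Sq]; norm_num [b₂, b₄, b₆]) (by decide) (by decide) (by decide)

/-- `258570dg2` = `[1,-1,1,-10100993,12757390481]` (class `258570dg`, (G-ord, `e = 2`) at `3`; twist `28730k2`, `a₃(V) = 1` — ANOMALOUS (outside the end state as typed); even line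
`φ = χ_{13}`): `x₀ = 1180`, `D = 13`, `s = 27625`, `Ψ₂Sq(x₀) = 9920828125` ⇒ `X3LineDatumThree W`. [folklore] -/
theorem x3LineDatumThree_258570dg2 : X3LineDatumThree (⟨1, -1, 1, -10100993, 12757390481⟩ : WeierstrassCurve ℚ) :=
  x3LineDatumThree_of_cert_of_delta _ (by norm_num [Δ, b₂, b₄, b₆, b₈]) 1180 27625 13
    (by simp only [Ψ₃, eval_add, eval_mul, eval_pow, eval_C, eval_X, eval_ofNat]; norm_num [b₂, b₄, b₆, b₈])
    (X2.CellACertN9.squarefree_of_nodup_primeFactorsList_natAbs (by norm_num) (by simp [Nat.primeFactorsList_ofNat])) (by norm_num)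
    (by rw [KernelDisc.eval_Ψ₂Sq]; norm_num [b₂, b₄, b₆]) (by decide) (by decide) (by decide)

/-- `258570s3` = `[1,-1,0,-6340320,1210291200]` (class `258570s`, (G-ord, `e = 2`) at `3`; twist `28730bc3`, `a₃(V) = -2` — ANOMALOUS (outside the end state as typed); even line
`φ = χ_{13}`): `x₀ = 3520`, `D = 13`, `s = 83200`, `Ψ₂Sq(x₀) = 89989120000` ⇒ `X3LineDatumThree W`. [folklore] -/
theorem x3LineDatumThree_258570s3 : X3LineDatumThree (⟨1, -1, 0, -6340320, 1210291200⟩ : WeierstrassCurve ℚ) :=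
  x3LineDatumThree_of_cert_of_delta _ (by norm_num [Δ, b₂, b₄, b₆, b₈]) 3520 83200 13
    (by simp only [Ψ₃, eval_add, eval_mul, eval_pow, eval_C, eval_X, eval_ofNat]; norm_num [b₂, b₄, b₆, b₈])
    (X2.CellACertN9.squarefree_of_nodup_primeFactorsList_natAbs (by norm_num) (by simp [Nat.primeFactorsList_ofNat])) (by norm_num)
    (by rw [KernelDisc.eval_Ψ₂Sq]; norm_num [b₂, b₄, b₆]) (by decide) (by decide) (by decide)

/-- `259920cd2` = `[0,0,0,-144516603,668689932202]` (class `259920cd`, (G-ord, `e = 2`) at `3`; twist `28880bf2`, `a₃(V) = 1` — ANOMALOUS (outside the end state as typed); even line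
`φ = χ_{19}`): `x₀ = 6897`, `D = 19`, `s = 2888`, `Ψ₂Sq(x₀) = 158470336` ⇒ `X3LineDatumThree W`. [folklore] -/
theorem x3LineDatumThree_259920cd2 : X3LineDatumThree (⟨0, 0, 0, -144516603, 668689932202⟩ : WeierstrassCurve ℚ) :=
  x3LineDatumThree_of_cert_of_delta _ (by norm_num [Δ, b₂, b₄, b₆, b₈]) 6897 2888 19
    (by simp only [Ψ₃, eval_add, eval_mul, eval_pow, eval_C, eval_X, eval_ofNat]; norm_num [b₂, b₄, b₆, b₈])
    (X2.CellACertN9.squarefree_of_nodup_primeFactorsList_natAbs (by norm_num) (by simp [Nat.primeFactorsList_ofNat])) (by norm_num)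
    (by rw [KernelDisc.eval_Ψ₂Sq]; norm_num [b₂, b₄, b₆]) (by decide) (by decide) (by decide)

/-- `260100cu2` = `[0,0,0,-12246375,17091098750]` (class `260100cu`, (G-ord, `e = 2`) at `3`; twist `28900i2`, `a₃(V) = -1`, non-anomalous; even line
`φ = χ_{17}`): `x₀ = 1275`, `D = 17`, `s = 28900`, `Ψ₂Sq(x₀) = 14198570000` ⇒ `X3LineDatumThree W`. [folklore] -/
theorem x3LineDatumThree_260100cu2 : X3LineDatumThree (⟨0, 0, 0, -12246375, 17091098750⟩ : WeierstrassCurve ℚ) :=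
  x3LineDatumThree_of_cert_of_delta _ (by norm_num [Δ, b₂, b₄, b₆, b₈]) 1275 28900 17
    (by simp only [Ψ₃, eval_add, eval_mul, eval_pow, eval_C, eval_X, eval_ofNat]; norm_num [b₂, b₄, b₆, b₈])
    (X2.CellACertN9.squarefree_of_nodup_primeFactorsList_natAbs (by norm_num) (by simp [Nat.primeFactorsList_ofNat])) (by norm_num)
    (by rw [KernelDisc.eval_Ψ₂Sq]; norm_num [b₂, b₄, b₆]) (by decide) (by decide) (by decide)

/-- `261450n2` = `[1,-1,0,9918,2164756]` (class `261450n`, (G-ord, `e = 2`) at `3`; twist `29050m2`, `a₃(V) = -1`, non-anomalous; even line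
`φ = χ_{5}`): `x₀ = 4`, `D = 5`, `s = 1328`, `Ψ₂Sq(x₀) = 8817920` ⇒ `X3LineDatumThree W`. [folklore] -/
theorem x3LineDatumThree_261450n2 : X3LineDatumThree (⟨1, -1, 0, 9918, 2164756⟩ : WeierstrassCurve ℚ) :=
  x3LineDatumThree_of_cert_of_delta _ (by norm_num [Δ, b₂, b₄, b₆, b₈]) 4 1328 5
    (by simp only [Ψ₃, eval_add, eval_mul, eval_pow, eval_C, eval_X, eval_ofNat]; norm_num [b₂, b₄, b₆, b₈])
    (X2.CellACertN9.squarefree_of_nodup_primeFactorsList_natAbs (by norm_num) (by simp [Nat.primeFactorsList_ofNat])) (by norm_num)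
    (by rw [KernelDisc.eval_Ψ₂Sq]; norm_num [b₂, b₄, b₆]) (by decide) (by decide) (by decide)

/-- `261612k2` = `[0,0,0,101400,-3365804]` (class `261612k`, (G-ord, `e = 2`) at `3`; twist `29068e2`, `a₃(V) = -2` — ANOMALOUS (outside the end state as typed); even line
`φ = χ_{13}`): `x₀ = 156`, `D = 13`, `s = 2236`, `Ψ₂Sq(x₀) = 64996048` ⇒ `X3LineDatumThree W`. [folklore] -/
theorem x3LineDatumThree_261612k2 : X3LineDatumThree (⟨0, 0, 0, 101400, -3365804⟩ : WeierstrassCurve ℚ) :=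
  x3LineDatumThree_of_cert_of_delta _ (by norm_num [Δ, b₂, b₄, b₆, b₈]) 156 2236 13
    (by simp only [Ψ₃, eval_add, eval_mul, eval_pow, eval_C, eval_X, eval_ofNat]; norm_num [b₂, b₄, b₆, b₈])
    (X2.CellACertN9.squarefree_of_nodup_primeFactorsList_natAbs (by norm_num) (by simp [Nat.primeFactorsList_ofNat])) (by norm_num)
    (by rw [KernelDisc.eval_Ψ₂Sq]; norm_num [b₂, b₄, b₆]) (by decide) (by decide) (by decide)

/-- `262080kx2` = `[0,0,0,2051814228,2328225221936]` (class `262080kx`, (G-ord, `e = 2`) at `3`; twist `29120g2`, `a₃(V) = -1`, non-anomalous; even line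
`φ = χ_{2}`): `x₀ = 16854`, `D = 2`, `s = 9132032`, `Ψ₂Sq(x₀) = 166788016898048` ⇒ `X3LineDatumThree W`. [folklore] -/
theorem x3LineDatumThree_262080kx2 : X3LineDatumThree (⟨0, 0, 0, 2051814228, 2328225221936⟩ : WeierstrassCurve ℚ) :=
  x3LineDatumThree_of_cert_of_delta _ (by norm_num [Δ, b₂, b₄, b₆, b₈]) 16854 9132032 2
    (by simp only [Ψ₃, eval_add, eval_mul, eval_pow, eval_C, eval_X, eval_ofNat]; norm_num [b₂, b₄, b₆, b₈])
    Int.prime_two.squarefree (by norm_num)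
    (by rw [KernelDisc.eval_Ψ₂Sq]; norm_num [b₂, b₄, b₆]) (by decide) (by decide) (by decide)

/-- `262350r2` = `[1,-1,0,609633,301422541]` (class `262350r`, (G-ord, `e = 2`) at `3`; twist `29150p2`, `a₃(V) = -1`, non-anomalous; even line
`φ = χ_{5}`): `x₀ = 94`, `D = 5`, `s = 16960`, `Ψ₂Sq(x₀) = 1438208000` ⇒ `X3LineDatumThree W`. [folklore] -/
theorem x3LineDatumThree_262350r2 : X3LineDatumThree (⟨1, -1, 0, 609633, 301422541⟩ : WeierstrassCurve ℚ) :=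
  x3LineDatumThree_of_cert_of_delta _ (by norm_num [Δ, b₂, b₄, b₆, b₈]) 94 16960 5
    (by simp only [Ψ₃, eval_add, eval_mul, eval_pow, eval_C, eval_X, eval_ofNat]; norm_num [b₂, b₄, b₆, b₈])
    (X2.CellACertN9.squarefree_of_nodup_primeFactorsList_natAbs (by norm_num) (by simp [Nat.primeFactorsList_ofNat])) (by norm_num)
    (by rw [KernelDisc.eval_Ψ₂Sq]; norm_num [b₂, b₄, b₆]) (by decide) (by decide) (by decide)

/-- `262701i2` = `[0,0,1,-18631830,30955040635]` (class `262701i`, (G-ord, `e = 2`) at `3`; twist `29189c2`, `a₃(V) = -1`, non-anomalous; even line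
`φ = χ_{17}`): `x₀ = 2499`, `D = 17`, `s = 289`, `Ψ₂Sq(x₀) = 1419857` ⇒ `X3LineDatumThree W`. [folklore] -/
theorem x3LineDatumThree_262701i2 : X3LineDatumThree (⟨0, 0, 1, -18631830, 30955040635⟩ : WeierstrassCurve ℚ) :=
  x3LineDatumThree_of_cert_of_delta _ (by norm_num [Δ, b₂, b₄, b₆, b₈]) 2499 289 17
    (by simp only [Ψ₃, eval_add, eval_mul, eval_pow, eval_C, eval_X, eval_ofNat]; norm_num [b₂, b₄, b₆, b₈])
    (X2.CellACertN9.squarefree_of_nodup_primeFactorsList_natAbs (by norm_num) (by simp [Nat.primeFactorsList_ofNat])) (by norm_num)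
    (by rw [KernelDisc.eval_Ψ₂Sq]; norm_num [b₂, b₄, b₆]) (by decide) (by decide) (by decide)

/-- `264915r2` = `[0,0,1,65598,1103602]` (class `264915r`, (G-ord, `e = 2`) at `3`; twist `29435c2`, `a₃(V) = -1`, non-anomalous; even line
`φ = χ_{29}`): `x₀ = 87`, `D = 29`, `s = 1015`, `Ψ₂Sq(x₀) = 29876525` ⇒ `X3LineDatumThree W`. [folklore] -/
theorem x3LineDatumThree_264915r2 : X3LineDatumThree (⟨0, 0, 1, 65598, 1103602⟩ : WeierstrassCurve ℚ) :=
  x3LineDatumThree_of_cert_of_delta _ (by norm_num [Δ, b₂, b₄, b₆, b₈]) 87 1015 29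
    (by simp only [Ψ₃, eval_add, eval_mul, eval_pow, eval_C, eval_X, eval_ofNat]; norm_num [b₂, b₄, b₆, b₈])
    (X2.CellACertN9.squarefree_of_nodup_primeFactorsList_natAbs (by norm_num) (by simp [Nat.primeFactorsList_ofNat])) (by norm_num)
    (by rw [KernelDisc.eval_Ψ₂Sq]; norm_num [b₂, b₄, b₆]) (by decide) (by decide) (by decide)

/-- `264915t2` = `[0,0,1,-53833538622,4992888209598292]` (class `264915t`, (G-ord, `e = 2`) at `3`; twist `29435d2`, `a₃(V) = -1`, non-anomalous; even line
`φ = χ_{29}`): `x₀ = 83607`, `D = 29`, `s = 12185075`, `Ψ₂Sq(x₀) = 4305805529913125` ⇒ `X3LineDatumThree W`. [folklore] -/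
theorem x3LineDatumThree_264915t2 : X3LineDatumThree (⟨0, 0, 1, -53833538622, 4992888209598292⟩ : WeierstrassCurve ℚ) :=
  x3LineDatumThree_of_cert_of_delta _ (by norm_num [Δ, b₂, b₄, b₆, b₈]) 83607 12185075 29
    (by simp only [Ψ₃, eval_add, eval_mul, eval_pow, eval_C, eval_X, eval_ofNat]; norm_num [b₂, b₄, b₆, b₈])
    (X2.CellACertN9.squarefree_of_nodup_primeFactorsList_natAbs (by norm_num) (by simp [Nat.primeFactorsList_ofNat])) (by norm_num)
    (by rw [KernelDisc.eval_Ψ₂Sq]; norm_num [b₂, b₄, b₆]) (by decide) (by decide) (by decide)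

/-- `265050bm2` = `[1,-1,0,-12783042,25476863116]` (class `265050bm`, (G-ord, `e = 2`) at `3`; twist `29450p2`, `a₃(V) = -1`, non-anomalous; even line
`φ = χ_{5}`): `x₀ = 634`, `D = 5`, `s = 118750`, `Ψ₂Sq(x₀) = 70507812500` ⇒ `X3LineDatumThree W`. [folklore] -/
theorem x3LineDatumThree_265050bm2 : X3LineDatumThree (⟨1, -1, 0, -12783042, 25476863116⟩ : WeierstrassCurve ℚ) :=
  x3LineDatumThree_of_cert_of_delta _ (by norm_num [Δ, b₂, b₄, b₆, b₈]) 634 118750 5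
    (by simp only [Ψ₃, eval_add, eval_mul, eval_pow, eval_C, eval_X, eval_ofNat]; norm_num [b₂, b₄, b₆, b₈])
    (X2.CellACertN9.squarefree_of_nodup_primeFactorsList_natAbs (by norm_num) (by simp [Nat.primeFactorsList_ofNat])) (by norm_num)
    (by rw [KernelDisc.eval_Ψ₂Sq]; norm_num [b₂, b₄, b₆]) (by decide) (by decide) (by decide)

/-- `266805cn2` = `[0,0,1,462462,20658118]` (class `266805cn`, (G-ord, `e = 2`) at `3`; twist `29645o2`, `a₃(V) = -1`, non-anomalous; even line
`φ = χ_{77}`): `x₀ = 231`, `D = 77`, `s = 2695`, `Ψ₂Sq(x₀) = 559252925` ⇒ `X3LineDatumThree W`. [folklore] -/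
theorem x3LineDatumThree_266805cn2 : X3LineDatumThree (⟨0, 0, 1, 462462, 20658118⟩ : WeierstrassCurve ℚ) :=
  x3LineDatumThree_of_cert_of_delta _ (by norm_num [Δ, b₂, b₄, b₆, b₈]) 231 2695 77
    (by simp only [Ψ₃, eval_add, eval_mul, eval_pow, eval_C, eval_X, eval_ofNat]; norm_num [b₂, b₄, b₆, b₈])
    (X2.CellACertN9.squarefree_of_nodup_primeFactorsList_natAbs (by norm_num) (by simp [Nat.primeFactorsList_ofNat])) (by norm_num)
    (by rw [KernelDisc.eval_Ψ₂Sq]; norm_num [b₂, b₄, b₆]) (by decide) (by decide) (by decide)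

/-- `267075k2` = `[0,0,1,183300,-13785719]` (class `267075k`, (G-ord, `e = 2`) at `3`; twist `29675e2`, `a₃(V) = -1`, non-anomalous; even line
`φ = χ_{5}`): `x₀ = 240`, `D = 5`, `s = 5935`, `Ψ₂Sq(x₀) = 176121125` ⇒ `X3LineDatumThree W`. [folklore] -/
theorem x3LineDatumThree_267075k2 : X3LineDatumThree (⟨0, 0, 1, 183300, -13785719⟩ : WeierstrassCurve ℚ) :=
  x3LineDatumThree_of_cert_of_delta _ (by norm_num [Δ, b₂, b₄, b₆, b₈]) 240 5935 5
    (by simp only [Ψ₃, eval_add, eval_mul, eval_pow, eval_C, eval_X, eval_ofNat]; norm_num [b₂, b₄, b₆, b₈])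
    (X2.CellACertN9.squarefree_of_nodup_primeFactorsList_natAbs (by norm_num) (by simp [Nat.primeFactorsList_ofNat])) (by norm_num)
    (by rw [KernelDisc.eval_Ψ₂Sq]; norm_num [b₂, b₄, b₆]) (by decide) (by decide) (by decide)

/-- `268992bh2` = `[0,0,0,-1088076,435201392]` (class `268992bh`, (G-ord, `e = 2`) at `3`; twist `29888g2`, `a₃(V) = -1`, non-anomalous; even line
`φ = χ_{2}`): `x₀ = 726`, `D = 2`, `s = 7472`, `Ψ₂Sq(x₀) = 111661568` ⇒ `X3LineDatumThree W`. [folklore] -/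
theorem x3LineDatumThree_268992bh2 : X3LineDatumThree (⟨0, 0, 0, -1088076, 435201392⟩ : WeierstrassCurve ℚ) :=
  x3LineDatumThree_of_cert_of_delta _ (by norm_num [Δ, b₂, b₄, b₆, b₈]) 726 7472 2
    (by simp only [Ψ₃, eval_add, eval_mul, eval_pow, eval_C, eval_X, eval_ofNat]; norm_num [b₂, b₄, b₆, b₈])
    Int.prime_two.squarefree (by norm_num)
    (by rw [KernelDisc.eval_Ψ₂Sq]; norm_num [b₂, b₄, b₆]) (by decide) (by decide) (by decide)

/-- `271062c2` = `[1,-1,0,-610146,1126566036]` (class `271062c`, (G-ord, `e = 2`) at `3`; twist `30118d2`, `a₃(V) = -2` — ANOMALOUS (outside the end state as typed); even line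
`φ = χ_{37}`): `x₀ = 28`, `D = 37`, `s = 10952`, `Ψ₂Sq(x₀) = 4438013248` ⇒ `X3LineDatumThree W`. [folklore] -/
theorem x3LineDatumThree_271062c2 : X3LineDatumThree (⟨1, -1, 0, -610146, 1126566036⟩ : WeierstrassCurve ℚ) :=
  x3LineDatumThree_of_cert_of_delta _ (by norm_num [Δ, b₂, b₄, b₆, b₈]) 28 10952 37
    (by simp only [Ψ₃, eval_add, eval_mul, eval_pow, eval_C, eval_X, eval_ofNat]; norm_num [b₂, b₄, b₆, b₈])
    (X2.CellACertN9.squarefree_of_nodup_primeFactorsList_natAbs (by norm_num) (by simp [Nat.primeFactorsList_ofNat])) (by norm_num)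
    (by rw [KernelDisc.eval_Ψ₂Sq]; norm_num [b₂, b₄, b₆]) (by decide) (by decide) (by decide)

/-- `272448cs2` = `[0,0,0,-10740,25832]` (class `272448cs`, (G-ord, `e = 2`) at `3`; twist `30272m2`, `a₃(V) = 2`, non-anomalous; even line
`φ = χ_{2}`): `x₀ = 150`, `D = 2`, `s = 1892`, `Ψ₂Sq(x₀) = 7159328` ⇒ `X3LineDatumThree W`. [folklore] -/
theorem x3LineDatumThree_272448cs2 : X3LineDatumThree (⟨0, 0, 0, -10740, 25832⟩ : WeierstrassCurve ℚ) :=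
  x3LineDatumThree_of_cert_of_delta _ (by norm_num [Δ, b₂, b₄, b₆, b₈]) 150 1892 2
    (by simp only [Ψ₃, eval_add, eval_mul, eval_pow, eval_C, eval_X, eval_ofNat]; norm_num [b₂, b₄, b₆, b₈])
    Int.prime_two.squarefree (by norm_num)
    (by rw [KernelDisc.eval_Ψ₂Sq]; norm_num [b₂, b₄, b₆]) (by decide) (by decide) (by decide)

/-- `273150u2` = `[1,-1,0,-1335042,-552243884]` (class `273150u`, (G-ord, `e = 2`) at `3`; twist `30350h2`, `a₃(V) = 2`, non-anomalous; even line
`φ = χ_{5}`): `x₀ = 1984`, `D = 5`, `s = 60700`, `Ψ₂Sq(x₀) = 18422450000` ⇒ `X3LineDatumThree W`. [folklore] -/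
theorem x3LineDatumThree_273150u2 : X3LineDatumThree (⟨1, -1, 0, -1335042, -552243884⟩ : WeierstrassCurve ℚ) :=
  x3LineDatumThree_of_cert_of_delta _ (by norm_num [Δ, b₂, b₄, b₆, b₈]) 1984 60700 5
    (by simp only [Ψ₃, eval_add, eval_mul, eval_pow, eval_C, eval_X, eval_ofNat]; norm_num [b₂, b₄, b₆, b₈])
    (X2.CellACertN9.squarefree_of_nodup_primeFactorsList_natAbs (by norm_num) (by simp [Nat.primeFactorsList_ofNat])) (by norm_num)
    (by rw [KernelDisc.eval_Ψ₂Sq]; norm_num [b₂, b₄, b₆]) (by decide) (by decide) (by decide)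

/-- `273150v2` = `[1,-1,0,-122922,336035956]` (class `273150v`, (G-ord, `e = 2`) at `3`; twist `30350g2`, `a₃(V) = 2`, non-anomalous; even line
`φ = χ_{5}`): `x₀ = 4`, `D = 5`, `s = 16384`, `Ψ₂Sq(x₀) = 1342177280` ⇒ `X3LineDatumThree W`. [folklore] -/
theorem x3LineDatumThree_273150v2 : X3LineDatumThree (⟨1, -1, 0, -122922, 336035956⟩ : WeierstrassCurve ℚ) :=
  x3LineDatumThree_of_cert_of_delta _ (by norm_num [Δ, b₂, b₄, b₆, b₈]) 4 16384 5
    (by simp only [Ψ₃, eval_add, eval_mul, eval_pow, eval_C, eval_X, eval_ofNat]; norm_num [b₂, b₄, b₆, b₈])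
    (X2.CellACertN9.squarefree_of_nodup_primeFactorsList_natAbs (by norm_num) (by simp [Nat.primeFactorsList_ofNat])) (by norm_num)
    (by rw [KernelDisc.eval_Ψ₂Sq]; norm_num [b₂, b₄, b₆]) (by decide) (by decide) (by decide)

/-- `273600jr2` = `[0,0,0,136500,-154586000]` (class `273600jr`, (G-ord, `e = 2`) at `3`; twist `30400d2`, `a₃(V) = 1` — ANOMALOUS (outside the end state as typed); even line
`φ = χ_{10}`): `x₀ = 750`, `D = 10`, `s = 12160`, `Ψ₂Sq(x₀) = 1478656000` ⇒ `X3LineDatumThree W`. [folklore] -/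
theorem x3LineDatumThree_273600jr2 : X3LineDatumThree (⟨0, 0, 0, 136500, -154586000⟩ : WeierstrassCurve ℚ) :=
  x3LineDatumThree_of_cert_of_delta _ (by norm_num [Δ, b₂, b₄, b₆, b₈]) 750 12160 10
    (by simp only [Ψ₃, eval_add, eval_mul, eval_pow, eval_C, eval_X, eval_ofNat]; norm_num [b₂, b₄, b₆, b₈])
    (X2.CellACertN9.squarefree_of_nodup_primeFactorsList_natAbs (by norm_num) (by simp [Nat.primeFactorsList_ofNat])) (by norm_num)
    (by rw [KernelDisc.eval_Ψ₂Sq]; norm_num [b₂, b₄, b₆]) (by decide) (by decide) (by decide)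

/-- `273600kf2` = `[0,0,0,-40032300,97490878000]` (class `273600kf`, (G-ord, `e = 2`) at `3`; twist `30400c2`, `a₃(V) = 1` — ANOMALOUS (outside the end state as typed); even line
`φ = χ_{10}`): `x₀ = 3630`, `D = 10`, `s = 1520`, `Ψ₂Sq(x₀) = 23104000` ⇒ `X3LineDatumThree W`. [folklore] -/
theorem x3LineDatumThree_273600kf2 : X3LineDatumThree (⟨0, 0, 0, -40032300, 97490878000⟩ : WeierstrassCurve ℚ) :=
  x3LineDatumThree_of_cert_of_delta _ (by norm_num [Δ, b₂, b₄, b₆, b₈]) 3630 1520 10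
    (by simp only [Ψ₃, eval_add, eval_mul, eval_pow, eval_C, eval_X, eval_ofNat]; norm_num [b₂, b₄, b₆, b₈])
    (X2.CellACertN9.squarefree_of_nodup_primeFactorsList_natAbs (by norm_num) (by simp [Nat.primeFactorsList_ofNat])) (by norm_num)
    (by rw [KernelDisc.eval_Ψ₂Sq]; norm_num [b₂, b₄, b₆]) (by decide) (by decide) (by decide)

/-- `273600kr2` = `[0,0,0,-8400,315250]` (class `273600kr`, (G-ord, `e = 2`) at `3`; twist `30400g2`, `a₃(V) = -2` — ANOMALOUS (outside the end state as typed); even line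
`φ = χ_{10}`): `x₀ = 30`, `D = 10`, `s = 190`, `Ψ₂Sq(x₀) = 361000` ⇒ `X3LineDatumThree W`. [folklore] -/
theorem x3LineDatumThree_273600kr2 : X3LineDatumThree (⟨0, 0, 0, -8400, 315250⟩ : WeierstrassCurve ℚ) :=
  x3LineDatumThree_of_cert_of_delta _ (by norm_num [Δ, b₂, b₄, b₆, b₈]) 30 190 10
    (by simp only [Ψ₃, eval_add, eval_mul, eval_pow, eval_C, eval_X, eval_ofNat]; norm_num [b₂, b₄, b₆, b₈])
    (X2.CellACertN9.squarefree_of_nodup_primeFactorsList_natAbs (by norm_num) (by simp [Nat.primeFactorsList_ofNat])) (by norm_num)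
    (by rw [KernelDisc.eval_Ψ₂Sq]; norm_num [b₂, b₄, b₆]) (by decide) (by decide) (by decide)

/-- `274950y2` = `[1,-1,0,326133,78969541]` (class `274950y`, (G-ord, `e = 2`) at `3`; twist `30550s2`, `a₃(V) = 2`, non-anomalous; even line
`φ = χ_{5}`): `x₀ = 94`, `D = 5`, `s = 9400`, `Ψ₂Sq(x₀) = 441800000` ⇒ `X3LineDatumThree W`. [folklore] -/
theorem x3LineDatumThree_274950y2 : X3LineDatumThree (⟨1, -1, 0, 326133, 78969541⟩ : WeierstrassCurve ℚ) :=
  x3LineDatumThree_of_cert_of_delta _ (by norm_num [Δ, b₂, b₄, b₆, b₈]) 94 9400 5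
    (by simp only [Ψ₃, eval_add, eval_mul, eval_pow, eval_C, eval_X, eval_ofNat]; norm_num [b₂, b₄, b₆, b₈])
    (X2.CellACertN9.squarefree_of_nodup_primeFactorsList_natAbs (by norm_num) (by simp [Nat.primeFactorsList_ofNat])) (by norm_num)
    (by rw [KernelDisc.eval_Ψ₂Sq]; norm_num [b₂, b₄, b₆]) (by decide) (by decide) (by decide)

/-- `279225s2` = `[0,0,1,-1489800,686585281]` (class `279225s`, (G-ord, `e = 2`) at `3`; twist `31025a2`, `a₃(V) = -1`, non-anomalous; even line
`φ = χ_{5}`): `x₀ = 960`, `D = 5`, `s = 10625`, `Ψ₂Sq(x₀) = 564453125` ⇒ `X3LineDatumThree W`. [folklore] -/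
theorem x3LineDatumThree_279225s2 : X3LineDatumThree (⟨0, 0, 1, -1489800, 686585281⟩ : WeierstrassCurve ℚ) :=
  x3LineDatumThree_of_cert_of_delta _ (by norm_num [Δ, b₂, b₄, b₆, b₈]) 960 10625 5
    (by simp only [Ψ₃, eval_add, eval_mul, eval_pow, eval_C, eval_X, eval_ofNat]; norm_num [b₂, b₄, b₆, b₈])
    (X2.CellACertN9.squarefree_of_nodup_primeFactorsList_natAbs (by norm_num) (by simp [Nat.primeFactorsList_ofNat])) (by norm_num)
    (by rw [KernelDisc.eval_Ψ₂Sq]; norm_num [b₂, b₄, b₆]) (by decide) (by decide) (by decide)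

/-- `283050bz2` = `[1,-1,0,30568833,6974758741]` (class `283050bz`, (G-ord, `e = 2`) at `3`; twist `31450p2`, `a₃(V) = -1`, non-anomalous; even line
`φ = χ_{5}`): `x₀ = 1984`, `D = 5`, `s = 245650`, `Ψ₂Sq(x₀) = 301719612500` ⇒ `X3LineDatumThree W`. [folklore] -/
theorem x3LineDatumThree_283050bz2 : X3LineDatumThree (⟨1, -1, 0, 30568833, 6974758741⟩ : WeierstrassCurve ℚ) :=
  x3LineDatumThree_of_cert_of_delta _ (by norm_num [Δ, b₂, b₄, b₆, b₈]) 1984 245650 5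
    (by simp only [Ψ₃, eval_add, eval_mul, eval_pow, eval_C, eval_X, eval_ofNat]; norm_num [b₂, b₄, b₆, b₈])
    (X2.CellACertN9.squarefree_of_nodup_primeFactorsList_natAbs (by norm_num) (by simp [Nat.primeFactorsList_ofNat])) (by norm_num)
    (by rw [KernelDisc.eval_Ψ₂Sq]; norm_num [b₂, b₄, b₆]) (by decide) (by decide) (by decide)

/-- `283509b2` = `[0,0,1,-2244,32287]` (class `283509b`, (G-ord, `e = 2`) at `3`; twist `31501a2`, `a₃(V) = -1`, non-anomalous; even line
`φ = χ_{17}`): `x₀ = 51`, `D = 17`, `s = 109`, `Ψ₂Sq(x₀) = 201977` ⇒ `X3LineDatumThree W`. [folklore] -/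
theorem x3LineDatumThree_283509b2 : X3LineDatumThree (⟨0, 0, 1, -2244, 32287⟩ : WeierstrassCurve ℚ) :=
  x3LineDatumThree_of_cert_of_delta _ (by norm_num [Δ, b₂, b₄, b₆, b₈]) 51 109 17
    (by simp only [Ψ₃, eval_add, eval_mul, eval_pow, eval_C, eval_X, eval_ofNat]; norm_num [b₂, b₄, b₆, b₈])
    (X2.CellACertN9.squarefree_of_nodup_primeFactorsList_natAbs (by norm_num) (by simp [Nat.primeFactorsList_ofNat])) (by norm_num)
    (by rw [KernelDisc.eval_Ψ₂Sq]; norm_num [b₂, b₄, b₆]) (by decide) (by decide) (by decide)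

/-- `283968ch2` = `[0,0,0,-337260,75464624]` (class `283968ch`, (G-ord, `e = 2`) at `3`; twist `31552l2`, `a₃(V) = 2`, non-anomalous; even line
`φ = χ_{2}`): `x₀ = 294`, `D = 2`, `s = 1856`, `Ψ₂Sq(x₀) = 6889472` ⇒ `X3LineDatumThree W`. [folklore] -/
theorem x3LineDatumThree_283968ch2 : X3LineDatumThree (⟨0, 0, 0, -337260, 75464624⟩ : WeierstrassCurve ℚ) :=
  x3LineDatumThree_of_cert_of_delta _ (by norm_num [Δ, b₂, b₄, b₆, b₈]) 294 1856 2
    (by simp only [Ψ₃, eval_add, eval_mul, eval_pow, eval_C, eval_X, eval_ofNat]; norm_num [b₂, b₄, b₆, b₈])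
    Int.prime_two.squarefree (by norm_num)
    (by rw [KernelDisc.eval_Ψ₂Sq]; norm_num [b₂, b₄, b₆]) (by decide) (by decide) (by decide)

/-- `284427be2` = `[0,0,1,-151086,51706944]` (class `284427be`, (G-ord, `e = 2`) at `3`; twist `31603a2`, `a₃(V) = 1` — ANOMALOUS (outside the end state as typed); even line
`φ = χ_{13}`): `x₀ = 39`, `D = 13`, `s = 3757`, `Ψ₂Sq(x₀) = 183495637` ⇒ `X3LineDatumThree W`. [folklore] -/
theorem x3LineDatumThree_284427be2 : X3LineDatumThree (⟨0, 0, 1, -151086, 51706944⟩ : WeierstrassCurve ℚ) :=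
  x3LineDatumThree_of_cert_of_delta _ (by norm_num [Δ, b₂, b₄, b₆, b₈]) 39 3757 13
    (by simp only [Ψ₃, eval_add, eval_mul, eval_pow, eval_C, eval_X, eval_ofNat]; norm_num [b₂, b₄, b₆, b₈])
    (X2.CellACertN9.squarefree_of_nodup_primeFactorsList_natAbs (by norm_num) (by simp [Nat.primeFactorsList_ofNat])) (by norm_num)
    (by rw [KernelDisc.eval_Ψ₂Sq]; norm_num [b₂, b₄, b₆]) (by decide) (by decide) (by decide)

/-- `286110bb2` = `[1,-1,0,23355,3409771]` (class `286110bb`, (G-ord, `e = 2`) at `3`; twist `31790t2`, `a₃(V) = -1`, non-anomalous; even line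
`φ = χ_{17}`): `x₀ = 13`, `D = 17`, `s = 935`, `Ψ₂Sq(x₀) = 14861825` ⇒ `X3LineDatumThree W`. [folklore] -/
theorem x3LineDatumThree_286110bb2 : X3LineDatumThree (⟨1, -1, 0, 23355, 3409771⟩ : WeierstrassCurve ℚ) :=
  x3LineDatumThree_of_cert_of_delta _ (by norm_num [Δ, b₂, b₄, b₆, b₈]) 13 935 17
    (by simp only [Ψ₃, eval_add, eval_mul, eval_pow, eval_C, eval_X, eval_ofNat]; norm_num [b₂, b₄, b₆, b₈])
    (X2.CellACertN9.squarefree_of_nodup_primeFactorsList_natAbs (by norm_num) (by simp [Nat.primeFactorsList_ofNat])) (by norm_num)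
    (by rw [KernelDisc.eval_Ψ₂Sq]; norm_num [b₂, b₄, b₆]) (by decide) (by decide) (by decide)

/-- `286110dq2` = `[1,-1,1,771142,-222720519]` (class `286110dq`, (G-ord, `e = 2`) at `3`; twist `31790h2`, `a₃(V) = -1`, non-anomalous; even line
`φ = χ_{17}`): `x₀ = 625`, `D = 17`, `s = 10880`, `Ψ₂Sq(x₀) = 2012364800` ⇒ `X3LineDatumThree W`. [folklore] -/
theorem x3LineDatumThree_286110dq2 : X3LineDatumThree (⟨1, -1, 1, 771142, -222720519⟩ : WeierstrassCurve ℚ) :=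
  x3LineDatumThree_of_cert_of_delta _ (by norm_num [Δ, b₂, b₄, b₆, b₈]) 625 10880 17
    (by simp only [Ψ₃, eval_add, eval_mul, eval_pow, eval_C, eval_X, eval_ofNat]; norm_num [b₂, b₄, b₆, b₈])
    (X2.CellACertN9.squarefree_of_nodup_primeFactorsList_natAbs (by norm_num) (by simp [Nat.primeFactorsList_ofNat])) (by norm_num)
    (by rw [KernelDisc.eval_Ψ₂Sq]; norm_num [b₂, b₄, b₆]) (by decide) (by decide) (by decide)

/-- `286272cm3` = `[0,0,0,-30066060,63454567664]` (class `286272cm`, (G-ord, `e = 2`) at `3`; twist `31808j3`, `a₃(V) = 2`, non-anomalous; even line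
`φ = χ_{2}`): `x₀ = 3174`, `D = 2`, `s = 1136`, `Ψ₂Sq(x₀) = 2580992` ⇒ `X3LineDatumThree W`. [folklore] -/
theorem x3LineDatumThree_286272cm3 : X3LineDatumThree (⟨0, 0, 0, -30066060, 63454567664⟩ : WeierstrassCurve ℚ) :=
  x3LineDatumThree_of_cert_of_delta _ (by norm_num [Δ, b₂, b₄, b₆, b₈]) 3174 1136 2
    (by simp only [Ψ₃, eval_add, eval_mul, eval_pow, eval_C, eval_X, eval_ofNat]; norm_num [b₂, b₄, b₆, b₈])
    Int.prime_two.squarefree (by norm_num)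
    (by rw [KernelDisc.eval_Ψ₂Sq]; norm_num [b₂, b₄, b₆]) (by decide) (by decide) (by decide)

/-- `286650gh2` = `[1,-1,0,633708,122193616]` (class `286650gh`, (G-ord, `e = 2`) at `3`; twist `31850bn2`, `a₃(V) = 2`, non-anomalous; even line
`φ = χ_{5}`): `x₀ = 184`, `D = 5`, `s = 14000`, `Ψ₂Sq(x₀) = 980000000` ⇒ `X3LineDatumThree W`. [folklore] -/
theorem x3LineDatumThree_286650gh2 : X3LineDatumThree (⟨1, -1, 0, 633708, 122193616⟩ : WeierstrassCurve ℚ) :=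
  x3LineDatumThree_of_cert_of_delta _ (by norm_num [Δ, b₂, b₄, b₆, b₈]) 184 14000 5
    (by simp only [Ψ₃, eval_add, eval_mul, eval_pow, eval_C, eval_X, eval_ofNat]; norm_num [b₂, b₄, b₆, b₈])
    (X2.CellACertN9.squarefree_of_nodup_primeFactorsList_natAbs (by norm_num) (by simp [Nat.primeFactorsList_ofNat])) (by norm_num)
    (by rw [KernelDisc.eval_Ψ₂Sq]; norm_num [b₂, b₄, b₆]) (by decide) (by decide) (by decide)

/-- `287451f2` = `[0,0,1,-141204,21727345]` (class `287451f`, (G-ord, `e = 2`) at `3`; twist `31939b2`, `a₃(V) = 2`, non-anomalous; even line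
`φ = χ_{41}`): `x₀ = 123`, `D = 41`, `s = 779`, `Ψ₂Sq(x₀) = 24880481` ⇒ `X3LineDatumThree W`. [folklore] -/
theorem x3LineDatumThree_287451f2 : X3LineDatumThree (⟨0, 0, 1, -141204, 21727345⟩ : WeierstrassCurve ℚ) :=
  x3LineDatumThree_of_cert_of_delta _ (by norm_num [Δ, b₂, b₄, b₆, b₈]) 123 779 41
    (by simp only [Ψ₃, eval_add, eval_mul, eval_pow, eval_C, eval_X, eval_ofNat]; norm_num [b₂, b₄, b₆, b₈])
    (X2.CellACertN9.squarefree_of_nodup_primeFactorsList_natAbs (by norm_num) (by simp [Nat.primeFactorsList_ofNat])) (by norm_num)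
    (by rw [KernelDisc.eval_Ψ₂Sq]; norm_num [b₂, b₄, b₆]) (by decide) (by decide) (by decide)

/-- `287622h2` = `[1,-1,0,71748,-58927280]` (class `287622h`, (G-ord, `e = 2`) at `3`; twist `31958h2`, `a₃(V) = -1`, non-anomalous; even line
`φ = χ_{29}`): `x₀ = 544`, `D = 29`, `s = 4408`, `Ψ₂Sq(x₀) = 563483456` ⇒ `X3LineDatumThree W`. [folklore] -/
theorem x3LineDatumThree_287622h2 : X3LineDatumThree (⟨1, -1, 0, 71748, -58927280⟩ : WeierstrassCurve ℚ) :=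
  x3LineDatumThree_of_cert_of_delta _ (by norm_num [Δ, b₂, b₄, b₆, b₈]) 544 4408 29
    (by simp only [Ψ₃, eval_add, eval_mul, eval_pow, eval_C, eval_X, eval_ofNat]; norm_num [b₂, b₄, b₆, b₈])
    (X2.CellACertN9.squarefree_of_nodup_primeFactorsList_natAbs (by norm_num) (by simp [Nat.primeFactorsList_ofNat])) (by norm_num)
    (by rw [KernelDisc.eval_Ψ₂Sq]; norm_num [b₂, b₄, b₆]) (by decide) (by decide) (by decide)

/-- `288990bf2` = `[1,-1,0,-2530215,-1838308419]` (class `288990bf`, (G-ord, `e = 2`) at `3`; twist `32110z2`, `a₃(V) = 1` — ANOMALOUS (outside the end state as typed); even line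
`φ = χ_{13}`): `x₀ = 2818`, `D = 13`, `s = 64220`, `Ψ₂Sq(x₀) = 53614709200` ⇒ `X3LineDatumThree W`. [folklore] -/
theorem x3LineDatumThree_288990bf2 : X3LineDatumThree (⟨1, -1, 0, -2530215, -1838308419⟩ : WeierstrassCurve ℚ) :=
  x3LineDatumThree_of_cert_of_delta _ (by norm_num [Δ, b₂, b₄, b₆, b₈]) 2818 64220 13
    (by simp only [Ψ₃, eval_add, eval_mul, eval_pow, eval_C, eval_X, eval_ofNat]; norm_num [b₂, b₄, b₆, b₈])
    (X2.CellACertN9.squarefree_of_nodup_primeFactorsList_natAbs (by norm_num) (by simp [Nat.primeFactorsList_ofNat])) (by norm_num)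
    (by rw [KernelDisc.eval_Ψ₂Sq]; norm_num [b₂, b₄, b₆]) (by decide) (by decide) (by decide)

/-- `288990gh2` = `[1,-1,1,-4228412,3347736149]` (class `288990gh`, (G-ord, `e = 2`) at `3`; twist `32110a2`, `a₃(V) = 1` — ANOMALOUS (outside the end state as typed); even line
`φ = χ_{13}`): `x₀ = 1180`, `D = 13`, `s = 247`, `Ψ₂Sq(x₀) = 793117` ⇒ `X3LineDatumThree W`. [folklore] -/
theorem x3LineDatumThree_288990gh2 : X3LineDatumThree (⟨1, -1, 1, -4228412, 3347736149⟩ : WeierstrassCurve ℚ) :=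
  x3LineDatumThree_of_cert_of_delta _ (by norm_num [Δ, b₂, b₄, b₆, b₈]) 1180 247 13
    (by simp only [Ψ₃, eval_add, eval_mul, eval_pow, eval_C, eval_X, eval_ofNat]; norm_num [b₂, b₄, b₆, b₈])
    (X2.CellACertN9.squarefree_of_nodup_primeFactorsList_natAbs (by norm_num) (by simp [Nat.primeFactorsList_ofNat])) (by norm_num)
    (by rw [KernelDisc.eval_Ψ₂Sq]; norm_num [b₂, b₄, b₆]) (by decide) (by decide) (by decide)

/-- `288990n2` = `[1,-1,0,-10035,911925]` (class `288990n`, (G-ord, `e = 2`) at `3`; twist `32110bb2`, `a₃(V) = 1` — ANOMALOUS (outside the end state as typed); even line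
`φ = χ_{13}`): `x₀ = 10`, `D = 13`, `s = 500`, `Ψ₂Sq(x₀) = 3250000` ⇒ `X3LineDatumThree W`. [folklore] -/
theorem x3LineDatumThree_288990n2 : X3LineDatumThree (⟨1, -1, 0, -10035, 911925⟩ : WeierstrassCurve ℚ) :=
  x3LineDatumThree_of_cert_of_delta _ (by norm_num [Δ, b₂, b₄, b₆, b₈]) 10 500 13
    (by simp only [Ψ₃, eval_add, eval_mul, eval_pow, eval_C, eval_X, eval_ofNat]; norm_num [b₂, b₄, b₆, b₈])
    (X2.CellACertN9.squarefree_of_nodup_primeFactorsList_natAbs (by norm_num) (by simp [Nat.primeFactorsList_ofNat])) (by norm_num)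
    (by rw [KernelDisc.eval_Ψ₂Sq]; norm_num [b₂, b₄, b₆]) (by decide) (by decide) (by decide)

/-- `289296v2` = `[0,0,0,2121,-6734]` (class `289296v`, (G-ord, `e = 2`) at `3`; twist `32144v2`, `a₃(V) = 1` — ANOMALOUS (outside the end state as typed); even line
`φ = χ_{7}`): `x₀ = 21`, `D = 7`, `s = 164`, `Ψ₂Sq(x₀) = 188272` ⇒ `X3LineDatumThree W`. [folklore] -/
theorem x3LineDatumThree_289296v2 : X3LineDatumThree (⟨0, 0, 0, 2121, -6734⟩ : WeierstrassCurve ℚ) :=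
  x3LineDatumThree_of_cert_of_delta _ (by norm_num [Δ, b₂, b₄, b₆, b₈]) 21 164 7
    (by simp only [Ψ₃, eval_add, eval_mul, eval_pow, eval_C, eval_X, eval_ofNat]; norm_num [b₂, b₄, b₆, b₈])
    (X2.CellACertN9.squarefree_of_nodup_primeFactorsList_natAbs (by norm_num) (by simp [Nat.primeFactorsList_ofNat])) (by norm_num)
    (by rw [KernelDisc.eval_Ψ₂Sq]; norm_num [b₂, b₄, b₆]) (by decide) (by decide) (by decide)

/-- `296208cm3` = `[0,0,0,-1795035,925542794]` (class `296208cm`, (G-ord, `e = 2`) at `3`; twist `32912bb3`, `a₃(V) = 2`, non-anomalous; even line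
`φ = χ_{11}`): `x₀ = 825`, `D = 11`, `s = 1496`, `Ψ₂Sq(x₀) = 24618176` ⇒ `X3LineDatumThree W`. [folklore] -/
theorem x3LineDatumThree_296208cm3 : X3LineDatumThree (⟨0, 0, 0, -1795035, 925542794⟩ : WeierstrassCurve ℚ) :=
  x3LineDatumThree_of_cert_of_delta _ (by norm_num [Δ, b₂, b₄, b₆, b₈]) 825 1496 11
    (by simp only [Ψ₃, eval_add, eval_mul, eval_pow, eval_C, eval_X, eval_ofNat]; norm_num [b₂, b₄, b₆, b₈])
    (X2.CellACertN9.squarefree_of_nodup_primeFactorsList_natAbs (by norm_num) (by simp [Nat.primeFactorsList_ofNat])) (by norm_num)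
    (by rw [KernelDisc.eval_Ψ₂Sq]; norm_num [b₂, b₄, b₆]) (by decide) (by decide) (by decide)

/-- `296208dh2` = `[0,0,0,-2145,38027]` (class `296208dh`, (G-ord, `e = 2`) at `3`; twist `32912ba2`, `a₃(V) = 2`, non-anomalous; even line
`φ = χ_{11}`): `x₀ = 33`, `D = 11`, `s = 34`, `Ψ₂Sq(x₀) = 12716` ⇒ `X3LineDatumThree W`. [folklore] -/
theorem x3LineDatumThree_296208dh2 : X3LineDatumThree (⟨0, 0, 0, -2145, 38027⟩ : WeierstrassCurve ℚ) :=
  x3LineDatumThree_of_cert_of_delta _ (by norm_num [Δ, b₂, b₄, b₆, b₈]) 33 34 11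
    (by simp only [Ψ₃, eval_add, eval_mul, eval_pow, eval_C, eval_X, eval_ofNat]; norm_num [b₂, b₄, b₆, b₈])
    (X2.CellACertN9.squarefree_of_nodup_primeFactorsList_natAbs (by norm_num) (by simp [Nat.primeFactorsList_ofNat])) (by norm_num)
    (by rw [KernelDisc.eval_Ψ₂Sq]; norm_num [b₂, b₄, b₆]) (by decide) (by decide) (by decide)

/-- `296208r2` = `[0,0,0,-1730784,2004826736]` (class `296208r`, (G-ord, `e = 2`) at `3`; twist `32912z2`, `a₃(V) = -1`, non-anomalous; even line
`φ = χ_{11}`): `x₀ = 132`, `D = 11`, `s = 25432`, `Ψ₂Sq(x₀) = 7114652864` ⇒ `X3LineDatumThree W`. [folklore] -/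
theorem x3LineDatumThree_296208r2 : X3LineDatumThree (⟨0, 0, 0, -1730784, 2004826736⟩ : WeierstrassCurve ℚ) :=
  x3LineDatumThree_of_cert_of_delta _ (by norm_num [Δ, b₂, b₄, b₆, b₈]) 132 25432 11
    (by simp only [Ψ₃, eval_add, eval_mul, eval_pow, eval_C, eval_X, eval_ofNat]; norm_num [b₂, b₄, b₆, b₈])
    (X2.CellACertN9.squarefree_of_nodup_primeFactorsList_natAbs (by norm_num) (by simp [Nat.primeFactorsList_ofNat])) (by norm_num)
    (by rw [KernelDisc.eval_Ψ₂Sq]; norm_num [b₂, b₄, b₆]) (by decide) (by decide) (by decide)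

end Summit.BirchSwinnertonDyer.Rank1Residual.Additive.X3ThreeLineDatumRecords
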